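import Summits.Ventures.HodgeRepro.CyclicPrimePowerNoSingleClass
import Summits.Ventures.HodgeRepro.CyclicTwoPrimesNoSingleClass
import Summits.Ventures.HodgeRepro.CyclicRecipe

/-!
# The cyclic classification in ONE statement

Blind re-derivation cell `pub-hodge-repro`, seat `p1` (gen 9).  On the cyclic group `ℤ/2m` with involution `m` (the
typer's model of a cyclic Galois CM field of degree `2m`), a single-class `SumTwo` quadruple of CM types without a
complex-conjugate pair — a single-class exceptional Pohlmann `4`-set in codimension `2` on the simple CM abelian `m`-fold
`A_Φ` — exists **if and only if** `m` has two distinct odd prime divisors `p ≠ q` and `m ≠ pq`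
(`cyclic_classification`).  The three ingredients are on the kernel already:

* «no» for `m = 2^a q^b` — `CyclicQuad.exists_conj_of_sumTwo_cyclic` (`CyclicPrimePowerNoSingleClass.lean`, the
  `q`-adic Fourier ladder);
* «no» for `m = pq` — `CyclicQuad.exists_conj_of_sumTwo_cyclic_two_primes` (`CyclicTwoPrimesNoSingleClass.lean`, the
  rectangle identity and the periodicity dichotomy);
* «yes» for `m = r p q`, `r ≥ 2` — `CyclicRecipe.exists_singleClass_sumTwo_primitive_cyclic_full` (`CyclicRecipe.lean`,
  the half-interval construction; the type is primitive, the `4`-set exceptional and a coset of no subgroup);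

plus the elementary factorisation dichotomy `two_odd_primes_or_prime_power`: every `m ≠ 0` is `2^a q^b` for an odd
prime `q`, or has two distinct odd prime divisors.
-/

set_option autoImplicit false

open Finset
open scoped Pointwise

namespace HodgeRepro.CyclicRecipe

/-- **Factorisation dichotomy**: every `m ≠ 0` is `2^a · q^b` for some odd prime `q` (`b = 0`, `q = 3` for a power of
two), or has two distinct odd prime divisors. -/
theorem two_odd_primes_or_prime_power {m : ℕ} (hm : m ≠ 0) :
    (∃ a b q : ℕ, q.Prime ∧ q ≠ 2 ∧ m = 2 ^ a * q ^ b) ∨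
    (∃ p q : ℕ, p.Prime ∧ q.Prime ∧ p ≠ 2 ∧ q ≠ 2 ∧ p ≠ q ∧ p ∣ m ∧ q ∣ m) := by
  obtain ⟨a, n, hn_odd, rfl⟩ := Nat.exists_eq_two_pow_mul_odd hm
  have hn0 : n ≠ 0 := hn_odd.pos.ne'
  by_cases hn1 : n = 1
  · left; exact ⟨a, 0, 3, Nat.prime_three, by norm_num, by rw [hn1, pow_zero]⟩
  · obtain ⟨q, hq, hqn⟩ := Nat.exists_prime_and_dvd hn1
    have hq2 : q ≠ 2 := by
      rintro rfl
      exact (Nat.not_odd_iff_even.mpr (even_iff_two_dvd.mpr hqn)) hn_odd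
    obtain ⟨b, n', hqn', hn'⟩ := Nat.exists_eq_pow_mul_and_not_dvd hn0 q hq.ne_one
    by_cases hn'1 : n' = 1
    · left; exact ⟨a, b, q, hq, hq2, by rw [hn', hn'1, mul_one]⟩
    · obtain ⟨p, hp, hpn'⟩ := Nat.exists_prime_and_dvd hn'1
      right
      have hpn : p ∣ n := by rw [hn']; exact Dvd.dvd.mul_left hpn' _
      have hp2 : p ≠ 2 := by
        rintro rfl
        exact (Nat.not_odd_iff_even.mpr (even_iff_two_dvd.mpr hpn)) hn_odd
      have hpq : p ≠ q := by rintro rfl; exact hqn' hpn'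
      exact ⟨p, q, hp, hq, hp2, hq2, hpq, Dvd.dvd.mul_left hpn _, Dvd.dvd.mul_left hqn _⟩

variable {N : ℕ} [NeZero N]

/-- The recipe in the `m`-form with the full conclusion: `p ∣ m`, `q ∣ m`, `m ≠ pq` give a primitive type, the
quadruple, no conjugate pair, an exceptional non-coset Pohlmann `4`-set. -/
theorem exists_full_of_dvd {m p q : ℕ} (hN : N = 2 * m) (hp : p.Prime) (hq : q.Prime) (hp2 : p ≠ 2) (hq2 : q ≠ 2)
    (hpq : p ≠ q) (hpm : p ∣ m) (hqm : q ∣ m) (hne : m ≠ p * q) :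
    ∃ (Φ : Finset (Multiplicative (ZMod N))) (g : Fin 4 → Multiplicative (ZMod N)),
      IsCMType (Multiplicative.ofAdd ((m : ℕ) : ZMod N)) Φ ∧ IsPrimitive Φ ∧
      SumTwo (fun i => rmul Φ (g i)) ∧
      (∀ i j : Fin 4, rmul Φ (g j) ≠ Multiplicative.ofAdd ((m : ℕ) : ZMod N) • rmul Φ (g i)) ∧
      IsExceptional (Multiplicative.ofAdd ((m : ℕ) : ZMod N)) Φ (twistSet g 1) ∧
      ¬ ∃ (H : Subgroup (Multiplicative (ZMod N))) (h : Multiplicative (ZMod N)),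
        ∀ x, x ∈ twistSet g 1 ↔ ∃ k ∈ H, x = k * h := by
  have hcop : Nat.Coprime p q := (Nat.coprime_primes hp hq).mpr hpq
  obtain ⟨r, hr⟩ := hcop.mul_dvd_of_dvd_of_dvd hpm hqm
  have hm0 : m ≠ 0 := by
    intro h; rw [h, Nat.mul_zero] at hN; exact (NeZero.ne N) hN
  have hr2 : 2 ≤ r := by
    rcases r with _ | _ | r
    · rw [Nat.mul_zero] at hr; exact absurd hr hm0
    · rw [Nat.mul_one] at hr; exact absurd hr hne
    · omega
  have hN' : N = 2 * (r * p * q) := by rw [hN, hr]; ring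
  have e : ((m : ℕ) : ZMod N) = ((r * p * q : ℕ) : ZMod N) := by rw [hr]; congr 1; ring
  rw [e]
  exact exists_singleClass_sumTwo_primitive_cyclic_full hN' hr2 hp hq hp2 hq2 hpq

/-- **THE CYCLIC CLASSIFICATION.**  On `(ℤ/2m, m)` a `SumTwo` quadruple of Galois twists of a CM type without a
complex-conjugate pair exists if and only if `m` has two distinct odd prime divisors `p ≠ q` and `m ≠ pq`.  («⇒»: `m` is
`2^a q^b` or has two odd primes `p, q`; in the first case and in the case `m = pq` the gen-8 theorems produce a
conjugate pair.  «⇐»: the recipe.) -/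
theorem cyclic_classification {m : ℕ} (hN : N = 2 * m) :
    (∃ (Φ : Finset (Multiplicative (ZMod N))) (g : Fin 4 → Multiplicative (ZMod N)),
        IsCMType (Multiplicative.ofAdd ((m : ℕ) : ZMod N)) Φ ∧ SumTwo (fun i => rmul Φ (g i)) ∧
        ∀ i j : Fin 4, rmul Φ (g j) ≠ Multiplicative.ofAdd ((m : ℕ) : ZMod N) • rmul Φ (g i)) ↔
    ∃ p q : ℕ, p.Prime ∧ q.Prime ∧ p ≠ 2 ∧ q ≠ 2 ∧ p ≠ q ∧ p ∣ m ∧ q ∣ m ∧ m ≠ p * q := by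
  have hm0 : m ≠ 0 := by
    intro h; rw [h, Nat.mul_zero] at hN; exact (NeZero.ne N) hN
  constructor
  · rintro ⟨Φ, g, hΦ, hs, hnc⟩
    rcases two_odd_primes_or_prime_power hm0 with ⟨a, b, q, hq, hq2, hm⟩ | ⟨p, q, hp, hq, hp2, hq2, hpq, hpm, hqm⟩
    · exfalso
      have hN' : N = 2 * (2 ^ a * q ^ b) := by rw [hN, hm]
      rw [hm] at hΦ hnc
      obtain ⟨i, j, hij⟩ := CyclicQuad.exists_conj_of_sumTwo_cyclic hq hq2 hN' Φ hΦ g hs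
      exact hnc i j hij
    · by_cases hne : m = p * q
      · exfalso
        have hN' : N = 2 * (p * q) := by rw [hN, hne]
        rw [hne] at hΦ hnc
        obtain ⟨i, j, hij⟩ := CyclicQuad.exists_conj_of_sumTwo_cyclic_two_primes hp hq hp2 hq2 hpq hN' Φ hΦ g hs
        exact hnc i j hij
      · exact ⟨p, q, hp, hq, hp2, hq2, hpq, hpm, hqm, hne⟩
  · rintro ⟨p, q, hp, hq, hp2, hq2, hpq, hpm, hqm, hne⟩
    obtain ⟨Φ, g, hΦ, -, hs, hnc, -, -⟩ := exists_full_of_dvd hN hp hq hp2 hq2 hpq hpm hqm hne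
    exact ⟨Φ, g, hΦ, hs, hnc⟩

/-- The classification with the strong «yes»: when a quadruple exists at all, one exists on a PRIMITIVE type with an
exceptional, non-coset Pohlmann `4`-set. -/
theorem exists_primitive_of_exists {m : ℕ} (hN : N = 2 * m)
    (h : ∃ (Φ : Finset (Multiplicative (ZMod N))) (g : Fin 4 → Multiplicative (ZMod N)),
        IsCMType (Multiplicative.ofAdd ((m : ℕ) : ZMod N)) Φ ∧ SumTwo (fun i => rmul Φ (g i)) ∧
        ∀ i j : Fin 4, rmul Φ (g j) ≠ Multiplicative.ofAdd ((m : ℕ) : ZMod N) • rmul Φ (g i)) :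
    ∃ (Φ : Finset (Multiplicative (ZMod N))) (g : Fin 4 → Multiplicative (ZMod N)),
      IsCMType (Multiplicative.ofAdd ((m : ℕ) : ZMod N)) Φ ∧ IsPrimitive Φ ∧
      SumTwo (fun i => rmul Φ (g i)) ∧
      (∀ i j : Fin 4, rmul Φ (g j) ≠ Multiplicative.ofAdd ((m : ℕ) : ZMod N) • rmul Φ (g i)) ∧
      IsExceptional (Multiplicative.ofAdd ((m : ℕ) : ZMod N)) Φ (twistSet g 1) ∧
      ¬ ∃ (H : Subgroup (Multiplicative (ZMod N))) (h : Multiplicative (ZMod N)),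
        ∀ x, x ∈ twistSet g 1 ↔ ∃ k ∈ H, x = k * h := by
  obtain ⟨p, q, hp, hq, hp2, hq2, hpq, hpm, hqm, hne⟩ := (cyclic_classification hN).mp h
  exact exists_full_of_dvd hN hp hq hp2 hq2 hpq hpm hqm hne

/-- Degree `60`: the classification at `m = 30 = 2 · 3 · 5`. -/
theorem classification_C60 :
    ∃ (Φ : Finset (Multiplicative (ZMod 60))) (g : Fin 4 → Multiplicative (ZMod 60)),
      IsCMType (Multiplicative.ofAdd ((30 : ℕ) : ZMod 60)) Φ ∧ SumTwo (fun i => rmul Φ (g i)) ∧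
      ∀ i j : Fin 4, rmul Φ (g j) ≠ Multiplicative.ofAdd ((30 : ℕ) : ZMod 60) • rmul Φ (g i) :=
  (cyclic_classification (N := 60) (m := 30) rfl).mpr ⟨3, 5, by norm_num, by norm_num, by norm_num, by norm_num,
    by norm_num, by norm_num, by norm_num, by norm_num⟩

/-- Degree `30`: the classification at `m = 15 = 3 · 5` — NO such quadruple (`m = pq`). -/
theorem classification_C30 :
    ¬ ∃ (Φ : Finset (Multiplicative (ZMod 30))) (g : Fin 4 → Multiplicative (ZMod 30)),
      IsCMType (Multiplicative.ofAdd ((15 : ℕ) : ZMod 30)) Φ ∧ SumTwo (fun i => rmul Φ (g i)) ∧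
      ∀ i j : Fin 4, rmul Φ (g j) ≠ Multiplicative.ofAdd ((15 : ℕ) : ZMod 30) • rmul Φ (g i) := by
  intro h
  obtain ⟨p, q, hp, hq, hp2, hq2, hpq, hpm, hqm, hne⟩ := (cyclic_classification (N := 30) (m := 15) rfl).mp h
  have h35 : ∀ x, x.Prime → x ∣ 15 → x = 3 ∨ x = 5 := by
    intro x hx hx15
    have h' : x ∣ 3 * 5 := hx15
    rcases (Nat.Prime.dvd_mul hx).mp h' with h | h
    · left; exact (Nat.prime_dvd_prime_iff_eq hx Nat.prime_three).mp h
    · right; exact (Nat.prime_dvd_prime_iff_eq hx Nat.prime_five).mp h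
  rcases h35 p hp hpm with rfl | rfl <;> rcases h35 q hq hqm with rfl | rfl <;> omega

/-- **The first cyclic degree is `60`**: for `m < 30` no `SumTwo` quadruple of twists of a CM type without a conjugate
pair exists on `(ℤ/2m, m)` (two distinct odd primes and a cofactor `≥ 2` force `m ≥ 2 · 3 · 5`), and one exists for
`m = 30`. -/
theorem first_cyclic_degree :
    (∀ m : ℕ, m < 30 → ∀ (N : ℕ) [NeZero N], N = 2 * m →
      ¬ ∃ (Φ : Finset (Multiplicative (ZMod N))) (g : Fin 4 → Multiplicative (ZMod N)),
        IsCMType (Multiplicative.ofAdd ((m : ℕ) : ZMod N)) Φ ∧ SumTwo (fun i => rmul Φ (g i)) ∧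
        ∀ i j : Fin 4, rmul Φ (g j) ≠ Multiplicative.ofAdd ((m : ℕ) : ZMod N) • rmul Φ (g i)) ∧
    (∃ (Φ : Finset (Multiplicative (ZMod 60))) (g : Fin 4 → Multiplicative (ZMod 60)),
        IsCMType (Multiplicative.ofAdd ((30 : ℕ) : ZMod 60)) Φ ∧ SumTwo (fun i => rmul Φ (g i)) ∧
        ∀ i j : Fin 4, rmul Φ (g j) ≠ Multiplicative.ofAdd ((30 : ℕ) : ZMod 60) • rmul Φ (g i)) := by
  refine ⟨?_, classification_C60⟩
  intro m hm N _ hN h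
  obtain ⟨p, q, hp, hq, hp2, hq2, hpq, hpm, hqm, hne⟩ := (cyclic_classification hN).mp h
  have hcop : Nat.Coprime p q := (Nat.coprime_primes hp hq).mpr hpq
  obtain ⟨r, hr⟩ := hcop.mul_dvd_of_dvd_of_dvd hpm hqm
  have hm0 : m ≠ 0 := by
    intro h0; rw [h0, Nat.mul_zero] at hN; exact (NeZero.ne N) hN
  have hr2 : 2 ≤ r := by
    rcases r with _ | _ | r
    · rw [Nat.mul_zero] at hr; exact absurd hr hm0
    · rw [Nat.mul_one] at hr; exact absurd hr hne
    · omega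
  have hp3 : 3 ≤ p := by have := hp.two_le; omega
  have hq3 : 3 ≤ q := by have := hq.two_le; omega
  obtain ⟨kp, hkp⟩ := hp.odd_of_ne_two hp2
  obtain ⟨kq, hkq⟩ := hq.odd_of_ne_two hq2
  have h15 : 15 ≤ p * q := by
    rcases Nat.lt_or_gt_of_ne hpq with h | h
    · have h5 : 5 ≤ q := by omega
      calc 15 = 3 * 5 := by norm_num
        _ ≤ p * q := Nat.mul_le_mul hp3 h5
    · have h5 : 5 ≤ p := by omega
      calc 15 = 5 * 3 := by norm_num
        _ ≤ p * q := Nat.mul_le_mul h5 hq3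
  have h30 : 30 ≤ m := by
    calc 30 = 15 * 2 := by norm_num
      _ ≤ p * q * r := Nat.mul_le_mul h15 hr2
      _ = m := hr.symm
  omega

end HodgeRepro.CyclicRecipe
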